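import Mathlib.Analysis.SpecialFunctions.Exp
import Mathlib.Analysis.SpecialFunctions.Pow.Real
import Mathlib.Data.Fintype.BigOperators
import HarnessLib

/-!
# Chernoff bounds for sums of independent indicators, as COUNTS on a finite product space

The moment-generating-function ("Chernoff") method of Motwani–Raghavan, *Randomized Algorithms*,
§4.1 (Thm. 4.1 upper tail, Thm. 4.2 lower tail), in the counting form a finite construction reads
off a uniform seed: the sample space is the set of all maps `ω : ι → X` (independent uniform
coordinates), the `i`-th trial succeeds iff `ω i ∈ good i` (coordinate-dependent success sets,
so NON-identically distributed trials are covered), and for a set `I₀` of trials we bound the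
NUMBER of `ω` whose success count on `I₀` is at most `μ − θ` / at least `μ + θ`, `μ = q·|I₀|`,
when every success set has at least / at most `q·|X|` elements:

* `card_filter_cnt_le_le_exp`, `card_filter_le_cnt_le_exp` — the raw exponential-moment
  bounds `|X|^{|ι|}·e^{λk}·Π_{i∈I₀}(1 − qᵢ(1−e^{−λ}))`-type estimates, packaged as
  `#{ω : cnt ≤ μ−θ} ≤ |X|^{|ι|}·exp(μλ² − λθ)` and `#{ω : cnt ≥ μ+θ} ≤ |X|^{|ι|}·exp(μλ² − λθ)`
  for every `λ ∈ [0,1]` (from `|e^{x} − 1 − x| ≤ x²`, `|x| ≤ 1`);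

These are the two concentration inputs of Srinivasan–Tripathi–Venkitesh 2021, Thm. 18
(sampling with replacement; random `𝔽_p`-linear forms), replacing Bernstein's inequality
(their Lemma 20) — the constants of that proof leave room for the weaker exponent `μλ² − λθ`.

## References

* R. Motwani, P. Raghavan, *Randomized Algorithms*, CUP 1995, §4.1, Theorems 4.1–4.2 and their
  proof (moment generating functions) [MotwaniRaghavan1995].
* S. Srinivasan, U. Tripathi, S. Venkitesh, SIAM J. Discrete Math. 35 (2021), Lemma 20
  [SrinivasanTripathiVenkitesh2021].
-/

noncomputable section

open Finset Real

namespace Literature.Probability.Independence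

namespace ChernoffCount

open scoped Classical

variable {ι X : Type*} [Fintype ι] [Fintype X]

/-! ### Product structure of the uniform measure on `ι → X` -/

/-- **Independence of the coordinates**: `Σ_{ω : ι → X} Π_i w_i(ω i) = Π_i Σ_x w_i(x)`.
[cite: MotwaniRaghavan1995, §4.1 (proof of Thm. 4.1: E[Π e^{tX_i}] = Π E[e^{tX_i}])] -/
theorem sum_prod_eq_prod_sum (w : ι → X → ℝ) :
    ∑ ω : ι → X, ∏ i, w i (ω i) = ∏ i, ∑ x, w i x := by
  rw [Finset.prod_univ_sum (fun _ : ι => (univ : Finset X)) (fun i x => w i x),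
    Fintype.piFinset_univ]

/-- The success count of `ω` on the trial set `I₀`. [cite: MotwaniRaghavan1995, §4.1 (X = Σ X_i)] -/
def cnt (good : ι → X → Prop) (I₀ : Finset ι) (ω : ι → X) : ℕ :=
  (I₀.filter fun i => good i (ω i)).card

/-- The per-coordinate weight `e^{s·[i ∈ I₀ ∧ ω i good]}`. [cite: MotwaniRaghavan1995, §4.1 (proof of Thm. 4.1)] -/
private def wt (good : ι → X → Prop) (I₀ : Finset ι) (s : ℝ)
    (i : ι) (x : X) : ℝ :=
  if i ∈ I₀ ∧ good i x then Real.exp s else 1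

omit [Fintype ι] [Fintype X] in
/-- The weights are positive. [folklore] -/
private theorem wt_pos (good : ι → X → Prop) (I₀ : Finset ι) (s : ℝ)
    (i : ι) (x : X) : 0 < wt good I₀ s i x := by
  unfold wt; split_ifs
  · exact Real.exp_pos _
  · exact one_pos

omit [Fintype X] in
/-- The product of the weights is `exp (s · cnt)`. [cite: MotwaniRaghavan1995, §4.1 (proof of Thm. 4.1)] -/
private theorem prod_wt_eq (good : ι → X → Prop) (I₀ : Finset ι)
    (s : ℝ) (ω : ι → X) : ∏ i, wt good I₀ s i (ω i) = Real.exp (s * (cnt good I₀ ω : ℝ)) := by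
  have h : ∀ i, wt good I₀ s i (ω i) =
      Real.exp (s * if i ∈ I₀ ∧ good i (ω i) then 1 else 0) := by
    intro i; unfold wt; split_ifs <;> simp
  rw [Finset.prod_congr rfl fun i _ => h i, ← Real.exp_sum, ← Finset.mul_sum]
  congr 2
  unfold cnt
  rw [Finset.card_filter, Nat.cast_sum]
  rw [← Finset.sum_filter_add_sum_filter_not (s := (univ : Finset ι)) (p := fun i => i ∈ I₀)]
  have h0 : ∑ i ∈ univ.filter (fun i => ¬ i ∈ I₀),
      (if i ∈ I₀ ∧ good i (ω i) then (1 : ℝ) else 0) = 0 :=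
    Finset.sum_eq_zero fun i hi => by
      rw [if_neg fun h => (Finset.mem_filter.1 hi).2 h.1]
  rw [h0, add_zero, Finset.filter_mem_eq_inter, Finset.univ_inter]
  push_cast
  refine Finset.sum_congr rfl fun i hi => ?_
  by_cases hg : good i (ω i) <;> simp [hg, hi]

omit [Fintype ι] in
/-- The sum of the weights of coordinate `i`: `|good_i|·e^s + (|X| − |good_i|)` on `I₀`, `|X|`
off `I₀`. [cite: MotwaniRaghavan1995, §4.1 (proof of Thm. 4.1: E[e^{tX_i}] = 1 + p_i(e^t − 1))] -/
private theorem sum_wt_eq (good : ι → X → Prop) (I₀ : Finset ι)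
    (s : ℝ) (i : ι) :
    ∑ x, wt good I₀ s i x =
      if i ∈ I₀ then ((univ.filter (good i)).card : ℝ) * Real.exp s +
        (Fintype.card X - (univ.filter (good i)).card) else Fintype.card X := by
  unfold wt
  split_ifs with hi
  · simp only [hi, true_and]
    rw [Finset.sum_ite, Finset.sum_const, Finset.sum_const, nsmul_eq_mul, nsmul_eq_mul, mul_one]
    congr 1
    rw [Finset.filter_not, Finset.card_sdiff_of_subset (Finset.filter_subset _ _), card_univ,
      Nat.cast_sub (Finset.card_le_univ _)]
  · simp [hi]

/-- `|e^x − 1 − x| ≤ x²` on `[-1,1]`, the two one-sided forms used below. [folklore] -/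
private theorem exp_sub_le_sq {x : ℝ} (hx : |x| ≤ 1) : Real.exp x - 1 - x ≤ x ^ 2 :=
  (abs_le.1 (Real.abs_exp_sub_one_sub_id_le hx)).2

/-! ### Upper tail -/

/-- **Raw exponential-moment bound, upper tail.** For `s ≥ 0` and any real threshold `k`:
`#{ω : k ≤ cnt} · e^{sk} ≤ Π_{i∈I₀}(|good_i| e^s + |X| − |good_i|) · |X|^{|ι∖I₀|}`.
[cite: MotwaniRaghavan1995, Theorem 4.1 (proof)] -/
theorem card_filter_le_cnt_mul_exp_le (good : ι → X → Prop)
    (I₀ : Finset ι) (k s : ℝ) (hs : 0 ≤ s) :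
    (((univ : Finset (ι → X)).filter fun ω => k ≤ (cnt good I₀ ω : ℝ)).card : ℝ) *
        Real.exp (s * k) ≤
      ∏ i, (if i ∈ I₀ then ((univ.filter (good i)).card : ℝ) * Real.exp s +
        (Fintype.card X - (univ.filter (good i)).card) else (Fintype.card X : ℝ)) := by
  have hrhs : ∏ i, (if i ∈ I₀ then ((univ.filter (good i)).card : ℝ) * Real.exp s +
        (Fintype.card X - (univ.filter (good i)).card) else (Fintype.card X : ℝ)) =
      ∑ ω : ι → X, ∏ i, wt good I₀ s i (ω i) := by
    rw [sum_prod_eq_prod_sum]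
    exact Finset.prod_congr rfl fun i _ => (sum_wt_eq good I₀ s i).symm
  rw [hrhs, Finset.card_eq_sum_ones, Nat.cast_sum, Finset.sum_mul]
  simp only [Nat.cast_one, one_mul]
  calc ∑ ω ∈ univ.filter (fun ω : ι → X => k ≤ (cnt good I₀ ω : ℝ)), Real.exp (s * k)
      ≤ ∑ ω ∈ univ.filter (fun ω : ι → X => k ≤ (cnt good I₀ ω : ℝ)),
          ∏ i, wt good I₀ s i (ω i) := by
        refine Finset.sum_le_sum fun ω hω => ?_
        rw [prod_wt_eq]
        exact Real.exp_le_exp.2 (mul_le_mul_of_nonneg_left (Finset.mem_filter.1 hω).2 hs)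
    _ ≤ ∑ ω : ι → X, ∏ i, wt good I₀ s i (ω i) :=
        Finset.sum_le_sum_of_subset_of_nonneg (Finset.filter_subset _ _) fun ω _ _ =>
          Finset.prod_nonneg fun i _ => (wt_pos good I₀ s i (ω i)).le

/-- **Chernoff upper tail as a count** (Motwani–Raghavan Thm. 4.1 via `e^x − 1 − x ≤ x²`): if
every success set on `I₀` has at most `q·|X|` elements (`q ≥ 0`), `μ = q·|I₀|`, then for every
`λ ∈ [0,1]` and every `θ`,
`#{ω : ι → X | cnt_{I₀}(ω) ≥ μ + θ} ≤ |X|^{|ι|} · exp(μλ² − λθ)`.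
[cite: MotwaniRaghavan1995, Theorem 4.1] -/
theorem card_filter_le_cnt_le_exp (good : ι → X → Prop)
    (I₀ : Finset ι) {q : ℝ} (hq : 0 ≤ q)
    (hgood : ∀ i ∈ I₀, ((univ.filter (good i)).card : ℝ) ≤ q * Fintype.card X)
    {lam : ℝ} (hlam0 : 0 ≤ lam) (hlam1 : lam ≤ 1) (θ : ℝ) :
    (((univ : Finset (ι → X)).filter fun ω => q * I₀.card + θ ≤ (cnt good I₀ ω : ℝ)).card : ℝ) ≤
      (Fintype.card X : ℝ) ^ Fintype.card ι * Real.exp (q * I₀.card * lam ^ 2 - lam * θ) := by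
  set N : ℝ := (Fintype.card X : ℝ) with hN
  have hN0 : 0 ≤ N := Nat.cast_nonneg _
  have h1 := card_filter_le_cnt_mul_exp_le good I₀ (q * I₀.card + θ) lam hlam0
  -- bound each factor
  have hes : 0 ≤ Real.exp lam - 1 := by have := Real.one_le_exp hlam0; linarith
  have hfac : ∀ i, (if i ∈ I₀ then ((univ.filter (good i)).card : ℝ) * Real.exp lam +
        (N - (univ.filter (good i)).card) else N) ≤
      if i ∈ I₀ then N * Real.exp (q * (Real.exp lam - 1)) else N := by
    intro i
    split_ifs with hi
    · have hA := hgood i hi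
      have h2 : ((univ.filter (good i)).card : ℝ) * Real.exp lam + (N - (univ.filter (good i)).card)
          = N + (univ.filter (good i)).card * (Real.exp lam - 1) := by ring
      rw [h2]
      have h3 : ((univ.filter (good i)).card : ℝ) * (Real.exp lam - 1) ≤ q * N * (Real.exp lam - 1) :=
        mul_le_mul_of_nonneg_right hA hes
      have h4 : 1 + q * (Real.exp lam - 1) ≤ Real.exp (q * (Real.exp lam - 1)) := by
        have := Real.add_one_le_exp (q * (Real.exp lam - 1)); linarith
      calc N + ((univ.filter (good i)).card : ℝ) * (Real.exp lam - 1)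
          ≤ N * (1 + q * (Real.exp lam - 1)) := by nlinarith
        _ ≤ N * Real.exp (q * (Real.exp lam - 1)) := mul_le_mul_of_nonneg_left h4 hN0
    · exact le_rfl
  have hfac0 : ∀ i, 0 ≤ (if i ∈ I₀ then ((univ.filter (good i)).card : ℝ) * Real.exp lam +
        (N - (univ.filter (good i)).card) else N) := by
    intro i
    split_ifs
    · have : ((univ.filter (good i)).card : ℝ) ≤ N := by
        rw [hN]; exact_mod_cast Finset.card_le_univ _
      have hc0 : (0 : ℝ) ≤ ((univ.filter (good i)).card : ℝ) := Nat.cast_nonneg _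
      nlinarith [Real.exp_nonneg lam]
    · exact hN0
  have hprod : ∏ i, (if i ∈ I₀ then ((univ.filter (good i)).card : ℝ) * Real.exp lam +
        (N - (univ.filter (good i)).card) else N) ≤
      ∏ i, (if i ∈ I₀ then N * Real.exp (q * (Real.exp lam - 1)) else N) :=
    Finset.prod_le_prod (fun i _ => hfac0 i) fun i _ => hfac i
  have hprod2 : ∏ i, (if i ∈ I₀ then N * Real.exp (q * (Real.exp lam - 1)) else N) =
      N ^ Fintype.card ι * Real.exp (I₀.card * (q * (Real.exp lam - 1))) := by
    have h : ∀ i, (if i ∈ I₀ then N * Real.exp (q * (Real.exp lam - 1)) else N) =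
        N * Real.exp (if i ∈ I₀ then q * (Real.exp lam - 1) else 0) := by
      intro i; split_ifs <;> simp
    rw [Finset.prod_congr rfl fun i _ => h i, Finset.prod_mul_distrib, Finset.prod_const,
      card_univ, ← Real.exp_sum]
    congr 2
    rw [Finset.sum_ite_mem, Finset.univ_inter, Finset.sum_const, nsmul_eq_mul]
  -- assemble
  have hexp : Real.exp (I₀.card * (q * (Real.exp lam - 1))) * Real.exp (-(lam * (q * I₀.card + θ)))
      ≤ Real.exp (q * I₀.card * lam ^ 2 - lam * θ) := by
    rw [← Real.exp_add]
    refine Real.exp_le_exp.2 ?_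
    have hl : Real.exp lam - 1 - lam ≤ lam ^ 2 :=
      exp_sub_le_sq (by rw [abs_of_nonneg hlam0]; exact hlam1)
    have hμ : 0 ≤ q * (I₀.card : ℝ) := mul_nonneg hq (Nat.cast_nonneg _)
    nlinarith
  have hek : 0 < Real.exp (lam * (q * I₀.card + θ)) := Real.exp_pos _
  calc (((univ : Finset (ι → X)).filter fun ω => q * I₀.card + θ ≤ (cnt good I₀ ω : ℝ)).card : ℝ)
      = (((univ : Finset (ι → X)).filter fun ω => q * I₀.card + θ ≤ (cnt good I₀ ω : ℝ)).card : ℝ)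
          * Real.exp (lam * (q * I₀.card + θ)) * Real.exp (-(lam * (q * I₀.card + θ))) := by
        rw [mul_assoc, ← Real.exp_add, add_neg_cancel, Real.exp_zero, mul_one]
    _ ≤ (N ^ Fintype.card ι * Real.exp (I₀.card * (q * (Real.exp lam - 1)))) *
          Real.exp (-(lam * (q * I₀.card + θ))) := by
        refine mul_le_mul_of_nonneg_right (h1.trans (hprod.trans hprod2.le)) (Real.exp_nonneg _)
    _ = N ^ Fintype.card ι * (Real.exp (I₀.card * (q * (Real.exp lam - 1))) *
          Real.exp (-(lam * (q * I₀.card + θ)))) := by ring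
    _ ≤ N ^ Fintype.card ι * Real.exp (q * I₀.card * lam ^ 2 - lam * θ) :=
        mul_le_mul_of_nonneg_left hexp (pow_nonneg hN0 _)

/-! ### Lower tail -/

/-- **Raw exponential-moment bound, lower tail.** For `s ≥ 0` and any real threshold `k`:
`#{ω : cnt ≤ k} · e^{-sk} ≤ Π_{i∈I₀}(|good_i| e^{-s} + |X| − |good_i|) · |X|^{|ι∖I₀|}`.
[cite: MotwaniRaghavan1995, Theorem 4.2 (proof)] -/
theorem card_filter_cnt_le_mul_exp_le (good : ι → X → Prop)
    (I₀ : Finset ι) (k s : ℝ) (hs : 0 ≤ s) :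
    (((univ : Finset (ι → X)).filter fun ω => (cnt good I₀ ω : ℝ) ≤ k).card : ℝ) *
        Real.exp (-(s * k)) ≤
      ∏ i, (if i ∈ I₀ then ((univ.filter (good i)).card : ℝ) * Real.exp (-s) +
        (Fintype.card X - (univ.filter (good i)).card) else (Fintype.card X : ℝ)) := by
  have hrhs : ∏ i, (if i ∈ I₀ then ((univ.filter (good i)).card : ℝ) * Real.exp (-s) +
        (Fintype.card X - (univ.filter (good i)).card) else (Fintype.card X : ℝ)) =
      ∑ ω : ι → X, ∏ i, wt good I₀ (-s) i (ω i) := by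
    rw [sum_prod_eq_prod_sum]
    exact Finset.prod_congr rfl fun i _ => (sum_wt_eq good I₀ (-s) i).symm
  rw [hrhs, Finset.card_eq_sum_ones, Nat.cast_sum, Finset.sum_mul]
  simp only [Nat.cast_one, one_mul]
  calc ∑ ω ∈ univ.filter (fun ω : ι → X => (cnt good I₀ ω : ℝ) ≤ k), Real.exp (-(s * k))
      ≤ ∑ ω ∈ univ.filter (fun ω : ι → X => (cnt good I₀ ω : ℝ) ≤ k),
          ∏ i, wt good I₀ (-s) i (ω i) := by
        refine Finset.sum_le_sum fun ω hω => ?_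
        rw [prod_wt_eq]
        refine Real.exp_le_exp.2 ?_
        have := mul_le_mul_of_nonneg_left (Finset.mem_filter.1 hω).2 hs
        linarith
    _ ≤ ∑ ω : ι → X, ∏ i, wt good I₀ (-s) i (ω i) :=
        Finset.sum_le_sum_of_subset_of_nonneg (Finset.filter_subset _ _) fun ω _ _ =>
          Finset.prod_nonneg fun i _ => (wt_pos good I₀ (-s) i (ω i)).le

/-- **Chernoff lower tail as a count** (Motwani–Raghavan Thm. 4.2 via `e^{-x} − 1 + x ≤ x²`): if
every success set on `I₀` has at least `q·|X|` elements (`q ≥ 0`), `μ = q·|I₀|`, then for every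
`λ ∈ [0,1]` and every `θ`,
`#{ω : ι → X | cnt_{I₀}(ω) ≤ μ − θ} ≤ |X|^{|ι|} · exp(μλ² − λθ)`.
[cite: MotwaniRaghavan1995, Theorem 4.2] -/
theorem card_filter_cnt_le_le_exp (good : ι → X → Prop)
    (I₀ : Finset ι) {q : ℝ} (hq : 0 ≤ q)
    (hgood : ∀ i ∈ I₀, q * Fintype.card X ≤ ((univ.filter (good i)).card : ℝ))
    {lam : ℝ} (hlam0 : 0 ≤ lam) (hlam1 : lam ≤ 1) (θ : ℝ) :
    (((univ : Finset (ι → X)).filter fun ω => (cnt good I₀ ω : ℝ) ≤ q * I₀.card - θ).card : ℝ) ≤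
      (Fintype.card X : ℝ) ^ Fintype.card ι * Real.exp (q * I₀.card * lam ^ 2 - lam * θ) := by
  set N : ℝ := (Fintype.card X : ℝ) with hN
  have hN0 : 0 ≤ N := Nat.cast_nonneg _
  have h1 := card_filter_cnt_le_mul_exp_le good I₀ (q * I₀.card - θ) lam hlam0
  have hes : 0 ≤ 1 - Real.exp (-lam) := by
    have := Real.exp_le_one_iff.2 (neg_nonpos.2 hlam0); linarith
  have hfac : ∀ i, (if i ∈ I₀ then ((univ.filter (good i)).card : ℝ) * Real.exp (-lam) +
        (N - (univ.filter (good i)).card) else N) ≤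
      if i ∈ I₀ then N * Real.exp (-(q * (1 - Real.exp (-lam)))) else N := by
    intro i
    split_ifs with hi
    · have hA := hgood i hi
      have h2 : ((univ.filter (good i)).card : ℝ) * Real.exp (-lam) + (N - (univ.filter (good i)).card)
          = N - (univ.filter (good i)).card * (1 - Real.exp (-lam)) := by ring
      rw [h2]
      have h3 : q * N * (1 - Real.exp (-lam)) ≤ ((univ.filter (good i)).card : ℝ) * (1 - Real.exp (-lam)) :=
        mul_le_mul_of_nonneg_right hA hes
      have h4 : 1 - q * (1 - Real.exp (-lam)) ≤ Real.exp (-(q * (1 - Real.exp (-lam)))) := by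
        have := Real.add_one_le_exp (-(q * (1 - Real.exp (-lam)))); linarith
      calc N - ((univ.filter (good i)).card : ℝ) * (1 - Real.exp (-lam))
          ≤ N * (1 - q * (1 - Real.exp (-lam))) := by nlinarith
        _ ≤ N * Real.exp (-(q * (1 - Real.exp (-lam)))) := mul_le_mul_of_nonneg_left h4 hN0
    · exact le_rfl
  have hfac0 : ∀ i, 0 ≤ (if i ∈ I₀ then ((univ.filter (good i)).card : ℝ) * Real.exp (-lam) +
        (N - (univ.filter (good i)).card) else N) := by
    intro i
    split_ifs
    · have : ((univ.filter (good i)).card : ℝ) ≤ N := by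
        rw [hN]; exact_mod_cast Finset.card_le_univ _
      have hc0 : (0 : ℝ) ≤ ((univ.filter (good i)).card : ℝ) := Nat.cast_nonneg _
      nlinarith [Real.exp_nonneg (-lam)]
    · exact hN0
  have hprod : ∏ i, (if i ∈ I₀ then ((univ.filter (good i)).card : ℝ) * Real.exp (-lam) +
        (N - (univ.filter (good i)).card) else N) ≤
      ∏ i, (if i ∈ I₀ then N * Real.exp (-(q * (1 - Real.exp (-lam)))) else N) :=
    Finset.prod_le_prod (fun i _ => hfac0 i) fun i _ => hfac i
  have hprod2 : ∏ i, (if i ∈ I₀ then N * Real.exp (-(q * (1 - Real.exp (-lam)))) else N) =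
      N ^ Fintype.card ι * Real.exp (I₀.card * -(q * (1 - Real.exp (-lam)))) := by
    have h : ∀ i, (if i ∈ I₀ then N * Real.exp (-(q * (1 - Real.exp (-lam)))) else N) =
        N * Real.exp (if i ∈ I₀ then -(q * (1 - Real.exp (-lam))) else 0) := by
      intro i; split_ifs <;> simp
    rw [Finset.prod_congr rfl fun i _ => h i, Finset.prod_mul_distrib, Finset.prod_const,
      card_univ, ← Real.exp_sum]
    congr 2
    rw [Finset.sum_ite_mem, Finset.univ_inter, Finset.sum_const, nsmul_eq_mul]
  have hexp : Real.exp (I₀.card * -(q * (1 - Real.exp (-lam)))) *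
        Real.exp (lam * (q * I₀.card - θ))
      ≤ Real.exp (q * I₀.card * lam ^ 2 - lam * θ) := by
    rw [← Real.exp_add]
    refine Real.exp_le_exp.2 ?_
    have hl : Real.exp (-lam) - 1 - (-lam) ≤ (-lam) ^ 2 :=
      exp_sub_le_sq (by rw [abs_neg, abs_of_nonneg hlam0]; exact hlam1)
    have hμ : 0 ≤ q * (I₀.card : ℝ) := mul_nonneg hq (Nat.cast_nonneg _)
    nlinarith
  calc (((univ : Finset (ι → X)).filter fun ω => (cnt good I₀ ω : ℝ) ≤ q * I₀.card - θ).card : ℝ)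
      = (((univ : Finset (ι → X)).filter fun ω => (cnt good I₀ ω : ℝ) ≤ q * I₀.card - θ).card : ℝ)
          * Real.exp (-(lam * (q * I₀.card - θ))) * Real.exp (lam * (q * I₀.card - θ)) := by
        rw [mul_assoc, ← Real.exp_add, neg_add_cancel, Real.exp_zero, mul_one]
    _ ≤ (N ^ Fintype.card ι * Real.exp (I₀.card * -(q * (1 - Real.exp (-lam))))) *
          Real.exp (lam * (q * I₀.card - θ)) := by
        refine mul_le_mul_of_nonneg_right (h1.trans (hprod.trans hprod2.le)) (Real.exp_nonneg _)
    _ = N ^ Fintype.card ι * (Real.exp (I₀.card * -(q * (1 - Real.exp (-lam)))) *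
          Real.exp (lam * (q * I₀.card - θ))) := by ring
    _ ≤ N ^ Fintype.card ι * Real.exp (q * I₀.card * lam ^ 2 - lam * θ) :=
        mul_le_mul_of_nonneg_left hexp (pow_nonneg hN0 _)

end ChernoffCount

end Literature.Probability.Independence
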